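import Literature.NumberTheory.Sieve.HeathBrownCubicTypeII
import Mathlib.MeasureTheory.Integral.Bochner.Basic
import Mathlib.Analysis.SpecialFunctions.Pow.Asymptotics
import HarnessLib

/-!
# Heath-Brown's Lemma 3.8 (Siegel–Walfisz for the weights `f`) from his Lemmas 8.1, 9.1, 9.2

Eighth layer of the decomposition of **parity.S18**
(`Literature.NumberTheory.Sieve.setOf_prime_cube_add_two_mul_cube_infinite`) along D. R. Heath-Brown,
*Primes represented by `x³ + 2y³`*, Acta Math. 186 (2001), 1–84, continuing `HeathBrownCubicTypeII`,
which vendors **Lemma 3.8** as the named fact `HeathBrown2001_lemma_3_8`: for a cube `𝒞` of side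
`S₀ ≥ L²` on which `x, y, z ≪ V^{1/3}` and `x³ + 2y³ + 4z³ − 6xyz ≫ V`, and `q ≤ (log X)^A`,
`∑_{β ≡ α (mod q), β̂ ∈ 𝒞} f_(β) ≪ V exp{−c√(log L)}` (pp. 18–19). Its proof occupies §8 (pp. 47–51)
and §9 (pp. 52–60) and consists of three printed lemmas and one sentence:

* **Lemma 8.1** (p. 47; the terms `e_(β)`): with `N(x, y, z) = x³ + 2y³ + 4z³ − 6xyz` and
  `𝓘 = ∫_𝒞 w'(N(𝐱)) dx dy dz`, for every positive integer `q ≤ L^{1/6}` and every `α ∈ ℤ[2^{1/3}]`,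
  `∑_{β ≡ α (q), β̂ ∈ 𝒞} e_(β) = γ₀⁻¹M⁻¹(ξ log X)^{−n−1} 𝓘 ε(α,q) φ_K(q)⁻¹ + O(S₀³M⁻¹τ(q)^c exp{−c√(log L)})`,
  `ε(α, q) = 1` if `α` and `q` are coprime and `0` otherwise, `M = ∏ m_i`, `φ_K` the Euler function of
  `K` (proved on pp. 47–51 from (8.3)–(8.5), Lemma 4.9, and — for the Möbius sums (8.7) — Perron's
  formula with "the standard zero-free region for `ζ_K(s)`");
* **Lemma 9.1** (p. 52): for `q ≤ L^{1/6}` and `α` NOT coprime to `q`, `∑_{β ≡ α (q), β̂ ∈ 𝒞} d_(β) = 0`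
  ("`(β)` will be a product of prime ideals `P_i` with `N(P_i) ≥ X^τ ≥ L > N(q)`, whence `β` and `q`
  must be coprime");
* **Lemma 9.2** (p. 52; the terms `d_(β)`): for a positive integer `A`, every natural number
  `q ≤ (log L)^A` and every `α` coprime to `q`,
  `∑_{β ≡ α (q), β̂ ∈ 𝒞} d_(β) = γ₀⁻¹M⁻¹φ_K(q)⁻¹(ξ log X)^{−n−1} 𝓘 + O_A(V exp{−c√(log L)})` ("the implied
  constant is ineffective, because of problems with Siegel zeros"; proved on pp. 52–60 from Hecke
  Grössencharaktere, Mitsui's prime ideal theorem with Grössencharakteren (Lemma 9.4), Lemmas 4.10,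
  9.3, 9.5);
* "A comparison of Lemmas 8.1, 9.1 and 9.2 immediately yields Lemma 3.8." (p. 52).

(G. Harman, *Prime-Detecting Sieves*, §13.6, restates the three as Lemmas 13.16, 13.17, 13.18 —
with the main terms `θ_n 𝓘 δ(α,q)/(γ₀ M φ_K(q))`, `θ_n = (ξ log X)^{−n−1}`, confirming the reading
`γ₀⁻¹` of the scanned original — and remarks "Clearly Lemma 13.6 follows immediately from Lemmas
13.16–13.18.")

## Content (namespace `Literature.NumberTheory.Sieve.CubicSieve`)

DEFINITIONS: `normForm` (`N(x, y, z)`), `cubeClassSum w q α 𝒞` (the generic sum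
`∑_{β ≡ α (mod q), β̂ ∈ 𝒞} w_(β)`, so that `swSum = cubeClassSum f`, `swSum_eq_cubeClassSum`),
`cubeIntegral` (`𝓘`), `eulerPhiK q = #(𝓞_K/(q))ˣ` (`φ_K(q)`), `coprimeInd α q` (`ε(α, q)`),
`swMainTerm = 𝓘/(γ₀ M φ_K(q) (ξ log X)^{n+1})` (the common main term of Lemmas 8.1 and 9.2).

PROVED: `swSum_eq_sub` (`∑ f = ∑ d − ∑ e`, (3.11)), `absNorm_span_natCast_K` (`N((q)) = q³`),
**`HeathBrown2001_lemma_9_1`** (Lemma 9.1, the printed proof), `side_pow_three_le_of_cubeCond`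
(`S₀³ ≤ 64c₃³V` for a cube as in Lemma 3.8), `card_divisors_rpow_le`,
`eventually_mul_loglog_rpow_le` and `eventually_lemma38_params` (the parameter bookkeeping behind
"immediately": for `τ = (log log X)^{−ϖ}`, `L = X^{τ/2}` and `X` large, `(log X)^A ≤ L^{1/6}`,
`(log X)^A ≤ (log L)^{A+1}`, `(log X)^B ≤ exp{(c/2)√(log L)}`), and the assembly
**`HeathBrown2001_lemma_3_8_of`**: Lemma 3.8 (`HeathBrown2001_lemma_3_8`, as rendered in
`HeathBrownCubicTypeII`) from Lemma 8.1 and Lemma 9.2, taken as the explicit hypotheses `h81`, `h92`.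

NO NAMED FACTS are introduced here (D-0026): Lemmas 8.1 and 9.2 — each a deep analytic result
(zero-free region of `ζ_K` with Perron's formula over `K`; Mitsui's theorem with possible Siegel
zeros) not available in Mathlib or the tree — appear only as the hypotheses of
`HeathBrown2001_lemma_3_8_of`, spelled out in full; vending them as named facts
`HeathBrown2001_lemma_8_1`, `HeathBrown2001_lemma_9_2` (the binder types verbatim) and closing
`HeathBrown2001_lemma_3_8_holds := HeathBrown2001_lemma_3_8_of …_holds …_holds` is left to the split of
`HeathBrown2001_lemma_3_8`.

## Faithfulness / modelling notes

* `φ_K(q)`, "the Euler function over the field `K`", is `#(𝓞_K/(q))ˣ` (`Nat.card`); "`α` and `q`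
  coprime" is `IsCoprime α q` in `𝓞_K` (the ideal `(α, q)` is `(1)`); `γ₀` is `gamma₀` of
  `HeathBrownCubicSieveSetup` (the residue of `ζ_K` at `1`, p. 6); `𝓘` is the Bochner/Lebesgue integral
  of `w'(N(𝐱))` (`wDeriv`, the right-hand derivative, p. 18) over `realCube a S₀` for the product
  Lebesgue measure on `ℝ × ℝ × ℝ`; `τ(q)` is `#(Nat.divisors q)`.
* Constants. Both lemmas are `≪`-statements inside the standing set-up (`τ = (log log X)^{−ϖ}`,
  `0 < ϖ < 1/5` ((2.5), (3.10)), `ξ = τ⁵`, `L = X^{τ/2}`, `X` large, `𝐦` subject to (3.5)–(3.7), the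
  cube as in Lemma 3.8 with implied constants `c₃, c₄`). The hypotheses `h81`, `h92` render them with
  the constants existentially quantified after `ϖ, c₃, c₄` (and `A` for 9.2) and before everything else
  — uniform in `X ≥ X₀`, `𝐦`, `q`, `α`, `V`, the cube — which is how p. 20 uses Lemma 3.8 (one bound
  summed over all `(n, 𝐦)`), and is weaker than the printed absolute constants; the two printed
  constants `c` of Lemma 8.1 (in `τ(q)^c` and in the exponent) are separate (`c'`, `c`), p. 6: "not
  necessarily the same at each occurrence". Lemma 9.2 keeps "`A` a positive integer" (`A : ℕ`); the
  real `A > 0` of Lemma 3.8 is served by `⌈A⌉ + 1` since `(log X)^A ≤ (log L)^{A+1}` for large `X`.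
* Lemma 9.1 is proved for every `X > 1`, `τ > 0`, `𝐦` satisfying (3.5)–(3.7) and `1 ≤ q ≤ L^{1/6}`
  (then `N(q)` has all prime ideal factors of norm `≤ q³ ≤ L^{1/2} = X^{τ/4} < X^τ ≤ N(P_i)`); `q ≥ 1`
  is needed (for `q = 0` the congruence degenerates to `β = α`).

## References

* D. R. Heath-Brown, *Primes represented by `x³ + 2y³`*, Acta Math. 186 (2001), 1–84: Lemma 3.8
  (pp. 18–19), §8 Lemma 8.1 (p. 47), §9 Lemmas 9.1, 9.2 (p. 52) and "A comparison of Lemmas 8.1, 9.1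
  and 9.2 immediately yields Lemma 3.8" (p. 52). [cite: HeathBrownActa2001, Lemmas 8.1, 9.1, 9.2]
* G. Harman, *Prime-Detecting Sieves*, LMS Monographs 33, Princeton (2007), §13.6, Lemmas 13.16–13.18
  and the remark after Lemma 13.18. [cite: Harman2007, §13.6]

## Mathlib / tree search

Mathlib: no Euler function of a number field / of an ideal (searched `totient` in `NumberField`,
`card_units_zmod`-analogues: only `ZMod`), no Hecke Grössencharakter `L`-functions, no zero-free
region for Dedekind zeta (so Lemmas 8.1, 9.2 stay hypotheses); used `Ideal.IsPrime.prod_le`,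
`Ideal.exists_le_maximal`, `Ideal.isCoprime_span_singleton_iff`, `Ideal.isCoprime_iff_sup_eq`,
`IsCoprime.sub_mul_left_left_iff`, `Ideal.absNorm_dvd_absNorm_of_le`, `isLittleO_rpow_exp_atTop`,
`tendsto_rpow_neg_atTop`, `Nat.card_divisors_le_self`. Tree: `HeathBrownCubicTypeII` (`swSum`,
`Hyp314`, `CubeCond`, `realCube`, `latticeCube`, `coordElt`, `dWeight`, `eWeight`, `fWeight`, `wDeriv`,
`CoreAdmissible`, `hbXi`, `hbL`, `mem_Jprimes_iff`, `one_le_prod_of_coreAdmissible`,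
`HeathBrown2001_lemma_3_8`), `HeathBrownCubicSieveDecomposition` (`hbTau`), `HeathBrownCubicSieveSetup`
(`gamma₀`), `LFunctions.IdealNormCount.absNorm_span_natCast`, `LFunctions.CubeRootTwoField.finrank_K`.
-/

noncomputable section

open Polynomial NumberField Finset Filter Topology MeasureTheory

namespace Literature.NumberTheory.Sieve.CubicSieve

open LFunctions.CubeRootTwoField CubicPrimes

section Defs

variable (X τ : ℝ)

/-! ### The objects of Lemmas 8.1 and 9.2 -/

/-- The norm form `N((x, y, z)) = x³ + 2y³ + 4z³ − 6xyz` (`= N_{K/ℚ}(x + y·2^{1/3} + z·2^{2/3})`,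
Lemma 8.1). [cite: HeathBrownActa2001, Lemma 8.1] -/
def normForm (p : ℝ × ℝ × ℝ) : ℝ :=
  p.1 ^ 3 + 2 * p.2.1 ^ 3 + 4 * p.2.2 ^ 3 - 6 * p.1 * p.2.1 * p.2.2

open scoped Classical in
/-- **`∑_{β ≡ α (mod q), β̂ ∈ 𝒞} w_(β)`** for a weight `w` on ideals: the sum of `w((β))` over the
`β = a + b·2^{1/3} + c·2^{2/3} ∈ ℤ[2^{1/3}]` whose coordinate vector `β̂ = (a, b, c)` lies in the cube
`𝒞 = ∏ (a_j, a_j + S₀]` and with `β ≡ α (mod q)` — the shape of the sums in Lemmas 3.8, 8.1, 9.1, 9.2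
(with `w = f, e, d, d`). [cite: HeathBrownActa2001, Lemma 3.8] -/
def cubeClassSum (w : Ideal (𝓞 K) → ℝ) (q : ℕ) (α : 𝓞 K) (a : ℝ × ℝ × ℝ) (S₀ : ℝ) : ℝ :=
  ∑ v ∈ (latticeCube a S₀).filter (fun v => (q : 𝓞 K) ∣ coordElt v - α),
    w (Ideal.span {coordElt v})

/-- **`𝓘 = ∫_𝒞 w'(N(𝐱)) dx dy dz`** (Lemma 8.1), `w' = w'(·, 𝐦)` the right-hand derivative of (3.12)
(`wDeriv`), for the Lebesgue measure on `ℝ³ = ℝ × ℝ × ℝ`. [cite: HeathBrownActa2001, Lemma 8.1] -/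
def cubeIntegral {k : ℕ} (m : Fin k → ℕ) (a : ℝ × ℝ × ℝ) (S₀ : ℝ) : ℝ :=
  ∫ p in realCube a S₀, wDeriv X τ m (normForm p)

/-- **`φ_K(q)`**, "the Euler function over the field `K`" at the ideal `(q)` of `𝓞_K = ℤ[2^{1/3}]`:
the number of invertible residue classes modulo `q` (Lemma 8.1). [cite: HeathBrownActa2001, Lemma 8.1] -/
def eulerPhiK (q : ℕ) : ℕ := Nat.card ((𝓞 K ⧸ Ideal.span {(q : 𝓞 K)})ˣ)

open scoped Classical in
/-- **`ε(α, q)`**: "`ε(α, q) = 1` if `α` and `q` are coprime, and `ε(α, q) = 0` otherwise"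
(Lemma 8.1); coprimality of `α` and `q` in `ℤ[2^{1/3}]` meaning that the ideal `(α, q)` is `(1)`
(`IsCoprime`). [cite: HeathBrownActa2001, Lemma 8.1] -/
def coprimeInd (α : 𝓞 K) (q : ℕ) : ℝ := if IsCoprime α (q : 𝓞 K) then 1 else 0

/-- **The main term `γ₀⁻¹ M⁻¹ φ_K(q)⁻¹ (ξ log X)^{−n−1} 𝓘`** common to Lemma 8.1 (where it carries the
factor `ε(α, q)`) and Lemma 9.2: `M = ∏_{i=1}^{n+1} m_i`, `γ₀` the residue of `ζ_K` at `1`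
(`gamma₀`), `ξ = τ⁵` (`hbXi`); here `k = n + 1` is the length of `𝐦`.
[cite: HeathBrownActa2001, Lemmas 8.1, 9.2] -/
def swMainTerm {k : ℕ} (m : Fin k → ℕ) (q : ℕ) (a : ℝ × ℝ × ℝ) (S₀ : ℝ) : ℝ :=
  cubeIntegral X τ m a S₀ /
    (gamma₀ * (∏ i, (m i : ℝ)) * (eulerPhiK q : ℝ) * (hbXi τ * Real.log X) ^ k)

variable {X τ}

/-- The sum of Lemma 3.8 / (3.14) is the generic cube sum with weight `f`. [cite: HeathBrownActa2001, Lemma 3.8] -/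
theorem swSum_eq_cubeClassSum {k : ℕ} (m : Fin k → ℕ) (q : ℕ) (α : 𝓞 K) (a : ℝ × ℝ × ℝ)
    (S₀ : ℝ) : swSum X τ m q α a S₀ = cubeClassSum (fWeight X τ m) q α a S₀ := rfl

/-- The cube sum is additive in the weight. [folklore] -/
theorem cubeClassSum_sub (w₁ w₂ : Ideal (𝓞 K) → ℝ) (q : ℕ) (α : 𝓞 K) (a : ℝ × ℝ × ℝ)
    (S₀ : ℝ) :
    cubeClassSum (fun S => w₁ S - w₂ S) q α a S₀ =
      cubeClassSum w₁ q α a S₀ - cubeClassSum w₂ q α a S₀ := by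
  simp only [cubeClassSum, sum_sub_distrib]

/-- `∑ f_(β) = ∑ d_(β) − ∑ e_(β)` over `β ≡ α (mod q)`, `β̂ ∈ 𝒞` ((3.11): `d_S = e_S + f_S`).
[cite: HeathBrownActa2001, §3 (3.11)] -/
theorem swSum_eq_sub {k : ℕ} (m : Fin k → ℕ) (q : ℕ) (α : 𝓞 K) (a : ℝ × ℝ × ℝ) (S₀ : ℝ) :
    swSum X τ m q α a S₀ =
      cubeClassSum (dWeight X τ m) q α a S₀ - cubeClassSum (eWeight X τ m) q α a S₀ := by
  rw [swSum_eq_cubeClassSum, ← cubeClassSum_sub]; rfl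

/-- `ε(α, q) = 1` for `α`, `q` coprime. [cite: HeathBrownActa2001, Lemma 8.1] -/
theorem coprimeInd_of_isCoprime {α : 𝓞 K} {q : ℕ} (h : IsCoprime α (q : 𝓞 K)) :
    coprimeInd α q = 1 := by
  classical
  exact if_pos h

/-- `ε(α, q) = 0` for `α`, `q` not coprime. [cite: HeathBrownActa2001, Lemma 8.1] -/
theorem coprimeInd_of_not_isCoprime {α : 𝓞 K} {q : ℕ} (h : ¬IsCoprime α (q : 𝓞 K)) :
    coprimeInd α q = 0 := by
  classical
  exact if_neg h

end Defs

/-! ### Lemma 9.1 -/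

/-- `N((q)) = q³` for a rational integer `q` in `𝓞_K`, `[K : ℚ] = 3`. [folklore] -/
theorem absNorm_span_natCast_K (q : ℕ) : Ideal.absNorm (Ideal.span {(q : 𝓞 K)}) = q ^ 3 := by
  rw [Literature.NumberTheory.LFunctions.IdealNormCount.absNorm_span_natCast K q, finrank_K]

/-- **Heath-Brown's Lemma 9.1** (p. 52; Harman's Lemma 13.17): "Let `𝒞 ⊆ ℝ³` be as in Lemma 3.8.
Then for any `q ≤ L^{1/6}` and any integer `α` we have `∑_{β ≡ α (mod q), β̂ ∈ 𝒞} d_(β) = 0` whenever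
`α` and `q` have a common factor. For the proof we merely note that `(β)` will be a product of prime
ideals `P_i` with `N(P_i) ≥ X^τ ≥ L > N(q)`, whence `β` and `q` must be coprime." Proved as printed,
for every `X > 1`, `τ > 0`, `𝐦` satisfying (3.5)–(3.7) and `1 ≤ q ≤ L^{1/6}`: a term with
`d_(β) ≠ 0` has `(β) = ∏ P_i`, `N(P_i) ≥ X^{m_iξ} ≥ X^τ`; as `β ≡ α (mod q)` and `(α, q) ≠ (1)`, some
maximal `P ∋ β, q`, so `P = P_i` for some `i` while `N(P) ∣ N((q)) = q³ ≤ L^{1/2} = X^{τ/4} < X^τ`.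
[cite: HeathBrownActa2001, Lemma 9.1] -/
theorem HeathBrown2001_lemma_9_1 {X τ : ℝ} (hX : 1 < X) (hτ : 0 < τ) {k : ℕ} {m : Fin k → ℕ}
    (hm : CoreAdmissible τ m) {q : ℕ} (hq1 : 1 ≤ q) (hq : (q : ℝ) ≤ hbL X τ ^ (1 / 6 : ℝ))
    {α : 𝓞 K} (hα : ¬IsCoprime α (q : 𝓞 K)) (a : ℝ × ℝ × ℝ) (S₀ : ℝ) :
    cubeClassSum (dWeight X τ m) q α a S₀ = 0 := by
  classical
  refine sum_eq_zero fun v hv => ?_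
  obtain ⟨-, hqv⟩ := mem_filter.mp hv
  set β := coordElt v with hβdef
  by_contra hd
  obtain ⟨P, hP, -⟩ := exists_ne_zero_of_sum_ne_zero hd
  rw [mem_filter, Fintype.mem_piFinset] at hP
  obtain ⟨hPJ, hPS⟩ := hP
  -- `β` is not coprime to `q`
  have hβ : ¬IsCoprime β (q : 𝓞 K) := by
    intro h
    apply hα
    obtain ⟨t, ht⟩ := hqv
    have : α = β - (q : 𝓞 K) * t := by rw [← ht]; ring
    rw [this]
    exact IsCoprime.sub_mul_left_left_iff.mpr h
  -- a maximal ideal above `β` and `q`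
  have hne : Ideal.span {β} ⊔ Ideal.span {(q : 𝓞 K)} ≠ ⊤ := by
    intro h
    exact hβ ((Ideal.isCoprime_span_singleton_iff β (q : 𝓞 K)).mp
      (Ideal.isCoprime_iff_sup_eq.mpr h))
  obtain ⟨Pm, hPm, hle⟩ := Ideal.exists_le_maximal _ hne
  have hβP : Ideal.span {β} ≤ Pm := le_sup_left.trans hle
  have hqP : (q : 𝓞 K) ∈ Pm := hle (Ideal.mem_sup_right (Ideal.mem_span_singleton_self _))
  rw [← hPS] at hβP
  obtain ⟨i, -, hi⟩ := hPm.isPrime.prod_le.mp hβP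
  have hJ := (mem_Jprimes_iff X τ).mp (hPJ i)
  have hEq : P i = Pm := (hJ.1.isMaximal hJ.2.1).eq_of_le hPm.ne_top hi
  -- `N(Pm) ∣ q³`
  have hdvd : Ideal.absNorm Pm ∣ q ^ 3 := by
    rw [← absNorm_span_natCast_K q]
    exact Ideal.absNorm_dvd_absNorm_of_le ((Ideal.span_singleton_le_iff_mem _).mpr hqP)
  have hq0 : 0 < q := hq1
  have hle3 : (Ideal.absNorm Pm : ℝ) ≤ (q : ℝ) ^ 3 := by
    exact_mod_cast Nat.le_of_dvd (pow_pos hq0 3) hdvd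
  have hX0 : 0 < X := by linarith
  -- `X^τ ≤ N(P i) = N(Pm)`
  have hlow : X ^ τ ≤ (Ideal.absNorm Pm : ℝ) := by
    rw [← hEq]
    refine le_trans (Real.rpow_le_rpow_of_exponent_le hX.le ?_) hJ.2.2.1
    have := hm.2.1 i
    rwa [div_le_iff₀ (hbXi_pos hτ)] at this
  -- `q³ ≤ L^{1/2} = X^{τ/4} < X^τ`
  have hup : (q : ℝ) ^ 3 ≤ X ^ (τ / 4) := by
    have hq0' : (0 : ℝ) ≤ q := Nat.cast_nonneg q
    calc (q : ℝ) ^ 3 ≤ (hbL X τ ^ (1 / 6 : ℝ)) ^ 3 := pow_le_pow_left₀ hq0' hq 3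
      _ = X ^ (τ / 4) := by
          rw [hbL, ← Real.rpow_mul hX0.le, ← Real.rpow_natCast, ← Real.rpow_mul hX0.le]
          norm_num
          ring_nf
  have hlt : X ^ (τ / 4) < X ^ τ := Real.rpow_lt_rpow_of_exponent_lt hX (by linarith)
  linarith

/-! ### The bookkeeping behind "immediately": cube side, `τ(q)`, and the parameters for large `X` -/

/-- For a cube `𝒞 = ∏ (a_j, a_j + S₀]` (`S₀ > 0`) on which `|x| ≤ c₃V^{1/3}`, the side satisfies
`S₀ ≤ 4c₃V^{1/3}`, so `S₀³ ≤ 64c₃³V` (compare `x = a₁ + S₀` and `x = a₁ + S₀/2`).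
[cite: HeathBrownActa2001, Lemma 3.8] -/
theorem side_pow_three_le_of_cubeCond {c₃ c₄ V : ℝ} {a : ℝ × ℝ × ℝ} {S₀ : ℝ} (hS₀ : 0 < S₀)
    (hV : 0 ≤ V) (h : CubeCond c₃ c₄ V a S₀) : S₀ ^ 3 ≤ 64 * c₃ ^ 3 * V := by
  have hp1 : (a.1 + S₀, a.2.1 + S₀, a.2.2 + S₀) ∈ realCube a S₀ := by
    simp only [realCube, Set.mem_prod, Set.mem_Ioc]
    exact ⟨⟨by linarith, le_rfl⟩, ⟨by linarith, le_rfl⟩, by linarith, le_rfl⟩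
  have hp2 : (a.1 + S₀ / 2, a.2.1 + S₀, a.2.2 + S₀) ∈ realCube a S₀ := by
    simp only [realCube, Set.mem_prod, Set.mem_Ioc]
    exact ⟨⟨by linarith, by linarith⟩, ⟨by linarith, le_rfl⟩, by linarith, le_rfl⟩
  have h1 := (h _ hp1).1
  have h2 := (h _ hp2).1
  simp only at h1 h2
  have hS : S₀ / 2 ≤ 2 * (c₃ * V ^ (1 / 3 : ℝ)) := by
    calc S₀ / 2 = |(a.1 + S₀) - (a.1 + S₀ / 2)| := by
          rw [abs_of_pos (by linarith)]; ring
      _ ≤ |a.1 + S₀| + |a.1 + S₀ / 2| := abs_sub _ _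
      _ ≤ c₃ * V ^ (1 / 3 : ℝ) + c₃ * V ^ (1 / 3 : ℝ) := add_le_add h1 h2
      _ = 2 * (c₃ * V ^ (1 / 3 : ℝ)) := by ring
  have hS' : S₀ ≤ 4 * c₃ * V ^ (1 / 3 : ℝ) := by linarith
  calc S₀ ^ 3 ≤ (4 * c₃ * V ^ (1 / 3 : ℝ)) ^ 3 := pow_le_pow_left₀ hS₀.le hS' 3
    _ = 64 * c₃ ^ 3 * (V ^ (1 / 3 : ℝ)) ^ (3 : ℕ) := by ring
    _ = 64 * c₃ ^ 3 * V := by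
        have h3 : (V ^ (1 / 3 : ℝ)) ^ (3 : ℕ) = V := by
          rw [← Real.rpow_natCast, ← Real.rpow_mul hV]; norm_num
        rw [h3]

/-- `τ(q)^c ≤ Q^{max(c, 0)}` for `1 ≤ q ≤ Q` (`1 ≤ τ(q) ≤ q`). [folklore] -/
theorem card_divisors_rpow_le {q : ℕ} (hq : 1 ≤ q) {Q : ℝ} (hqQ : (q : ℝ) ≤ Q) (c : ℝ) :
    ((Nat.divisors q).card : ℝ) ^ c ≤ Q ^ max c 0 := by
  have h1 : (1 : ℝ) ≤ (Nat.divisors q).card := by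
    have : 0 < (Nat.divisors q).card :=
      Finset.card_pos.mpr ⟨1, Nat.one_mem_divisors.mpr (by omega)⟩
    exact_mod_cast this
  have h2 : ((Nat.divisors q).card : ℝ) ≤ q := by exact_mod_cast Nat.card_divisors_le_self q
  calc ((Nat.divisors q).card : ℝ) ^ c ≤ ((Nat.divisors q).card : ℝ) ^ max c 0 :=
        Real.rpow_le_rpow_of_exponent_le h1 (le_max_left _ _)
    _ ≤ (q : ℝ) ^ max c 0 := Real.rpow_le_rpow (by positivity) h2 (le_max_right _ _)
    _ ≤ Q ^ max c 0 := Real.rpow_le_rpow (Nat.cast_nonneg _) hqQ (le_max_right _ _)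

/-- Eventually (in `X`) `C (log log X)^s ≤ log X`, for all real `s`, `C` (`u^s = o(e^u)`). [folklore] -/
theorem eventually_mul_loglog_rpow_le (s C : ℝ) :
    ∀ᶠ X : ℝ in atTop, C * Real.log (Real.log X) ^ s ≤ Real.log X := by
  have h := (isLittleO_rpow_exp_atTop s).def (show (0 : ℝ) < 1 / (|C| + 1) by positivity)
  have hT : Tendsto (fun X : ℝ => Real.log (Real.log X)) atTop atTop :=
    Real.tendsto_log_atTop.comp Real.tendsto_log_atTop
  filter_upwards [hT.eventually h, hT.eventually (eventually_ge_atTop (0 : ℝ)),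
    Real.tendsto_log_atTop.eventually (eventually_gt_atTop (0 : ℝ))] with X hX hM0 hL0
  have hM0' : (0 : ℝ) ≤ Real.log (Real.log X) := hM0
  rw [Real.exp_log hL0, Real.norm_eq_abs, Real.norm_eq_abs,
    abs_of_nonneg (Real.rpow_nonneg hM0' _), abs_of_pos hL0] at hX
  have hpow : 0 ≤ Real.log (Real.log X) ^ s := Real.rpow_nonneg hM0' _
  calc C * Real.log (Real.log X) ^ s ≤ (|C| + 1) * Real.log (Real.log X) ^ s := by
        apply mul_le_mul_of_nonneg_right _ hpow
        linarith [le_abs_self C]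
    _ ≤ (|C| + 1) * (1 / (|C| + 1) * Real.log X) := by gcongr
    _ = Real.log X := by field_simp

/-- **The parameters for large `X`** (`τ = (log log X)^{−ϖ}`, `ϖ > 0`, `L = X^{τ/2}`): eventually
`X ≥ 2`, `0 < τ ≤ 1/4`, `log L ≥ 1`, `(log X)^A ≤ L^{1/6}` (the range of Lemmas 8.1, 9.1 contains
`q ≤ (log X)^A`), `(log X)^A ≤ (log L)^{A+1}` (the range of Lemma 9.2 with `A + 1`), and
`(log X)^B ≤ exp{δ√(log L)}` (powers of `log X`, such as `τ(q)^c`, are absorbed by the saving). All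
reduce to `C (log log X)^s ≤ log X`. [folklore] -/
theorem eventually_lemma38_params {ϖ : ℝ} (hϖ0 : 0 < ϖ) (A B : ℝ) {δ : ℝ} (hδ : 0 < δ) :
    ∀ᶠ X : ℝ in atTop,
      2 ≤ X ∧ 0 < hbTau ϖ X ∧ hbTau ϖ X ≤ 1 / 4 ∧ 1 ≤ Real.log (hbL X (hbTau ϖ X)) ∧
        Real.log X ^ A ≤ hbL X (hbTau ϖ X) ^ (1 / 6 : ℝ) ∧
        Real.log X ^ A ≤ Real.log (hbL X (hbTau ϖ X)) ^ (A + 1) ∧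
        Real.log X ^ B ≤ Real.exp (δ * Real.sqrt (Real.log (hbL X (hbTau ϖ X)))) := by
  have hT : Tendsto (fun X : ℝ => Real.log (Real.log X)) atTop atTop :=
    Real.tendsto_log_atTop.comp Real.tendsto_log_atTop
  have hτ0 : Tendsto (fun X : ℝ => hbTau ϖ X) atTop (𝓝 0) := by
    have : (fun X : ℝ => hbTau ϖ X) = fun X => (Real.log (Real.log X)) ^ (-ϖ) := rfl
    rw [this]
    exact (tendsto_rpow_neg_atTop hϖ0).comp hT
  have hτ4 : ∀ᶠ X : ℝ in atTop, hbTau ϖ X ≤ 1 / 4 := hτ0.eventually (ge_mem_nhds (by norm_num))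
  filter_upwards [eventually_ge_atTop (2 : ℝ), hτ4, hT.eventually (eventually_ge_atTop (1 : ℝ)),
    eventually_mul_loglog_rpow_le ϖ 2, eventually_mul_loglog_rpow_le (1 + ϖ) (12 * A),
    eventually_mul_loglog_rpow_le (ϖ * (A + 1)) (2 ^ (A + 1)),
    eventually_mul_loglog_rpow_le (2 + ϖ) (2 * B ^ 2 / δ ^ 2)] with X hX2 hτ4X hM1 h1 h2 h3 h4
  set Lx := Real.log X with hLx
  set M := Real.log Lx with hM
  have hM1' : (1 : ℝ) ≤ M := hM1
  have hX0 : 0 < X := by linarith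
  have hLx0 : 0 < Lx := Real.log_pos (by linarith)
  have hM0 : 0 < M := by linarith
  have hτ : hbTau ϖ X = M ^ (-ϖ) := rfl
  set τ := hbTau ϖ X with hτdef
  have hτpos : 0 < τ := by rw [hτ]; exact Real.rpow_pos_of_pos hM0 _
  -- `τ · M^{s+ϖ} = M^s`
  have key : ∀ s : ℝ, τ * M ^ (s + ϖ) = M ^ s := fun s => by
    rw [hτ, ← Real.rpow_add hM0]; ring_nf
  have hL : Real.log (hbL X τ) = τ / 2 * Lx := by
    rw [hbL, Real.log_rpow hX0]
  have hLpos : 0 < hbL X τ := hbL_pos hX0 τ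
  -- (a) `1 ≤ log L`
  have ha : 1 ≤ τ / 2 * Lx := by
    have : τ * (2 * M ^ ϖ) ≤ τ * Lx := mul_le_mul_of_nonneg_left h1 hτpos.le
    have h' : τ * (2 * M ^ ϖ) = 2 := by
      have := key 0
      rw [zero_add, Real.rpow_zero] at this
      linarith [this]
    linarith
  refine ⟨hX2, hτpos, hτ4X, by rwa [hL], ?_, ?_, ?_⟩
  · -- (i) `(log X)^A ≤ L^{1/6} = exp(τ Lx / 12)`
    have hAM : A * M ≤ τ / 2 * Lx * (1 / 6) := by
      have : τ * (12 * A * M ^ (1 + ϖ)) ≤ τ * Lx := mul_le_mul_of_nonneg_left h2 hτpos.le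
      have h' : τ * (12 * A * M ^ (1 + ϖ)) = 12 * A * M := by
        have := key 1
        rw [Real.rpow_one] at this
        calc τ * (12 * A * M ^ (1 + ϖ)) = 12 * A * (τ * M ^ (1 + ϖ)) := by ring
          _ = 12 * A * M := by rw [this]
      linarith
    calc Lx ^ A = Real.exp (Real.log Lx * A) := Real.rpow_def_of_pos hLx0 A
      _ ≤ Real.exp (Real.log (hbL X τ) * (1 / 6)) := by
          rw [hL, ← hM]; exact Real.exp_le_exp.mpr (by linarith)
      _ = hbL X τ ^ (1 / 6 : ℝ) := (Real.rpow_def_of_pos hLpos _).symm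
  · -- (ii) `(log X)^A ≤ (log L)^{A+1}`
    have hq : (2 / τ) ^ (A + 1) ≤ Lx := by
      have h2τ : 2 / τ = 2 * M ^ ϖ := by
        rw [hτ, Real.rpow_neg hM0.le]; field_simp
      rw [h2τ, Real.mul_rpow (by norm_num) (Real.rpow_nonneg hM0.le _), ← Real.rpow_mul hM0.le]
      exact h3
    have hq0 : 0 < (2 / τ) ^ (A + 1) := Real.rpow_pos_of_pos (by positivity) _
    have hone : 1 ≤ (τ / 2) ^ (A + 1) * Lx := by
      have hinv : (τ / 2) ^ (A + 1) = ((2 / τ) ^ (A + 1))⁻¹ := by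
        rw [← Real.inv_rpow (by positivity)]; congr 1; field_simp
      rw [hinv, ← div_eq_inv_mul, le_div_iff₀ hq0, one_mul]
      exact hq
    have hLA : 0 ≤ Lx ^ A := Real.rpow_nonneg hLx0.le A
    calc Lx ^ A = Lx ^ A * 1 := (mul_one _).symm
      _ ≤ Lx ^ A * ((τ / 2) ^ (A + 1) * Lx) := mul_le_mul_of_nonneg_left hone hLA
      _ = (τ / 2) ^ (A + 1) * (Lx ^ A * Lx) := by ring
      _ = (τ / 2) ^ (A + 1) * Lx ^ (A + 1) := by rw [Real.rpow_add_one hLx0.ne']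
      _ = (τ / 2 * Lx) ^ (A + 1) := by rw [Real.mul_rpow (by positivity) hLx0.le]
      _ = Real.log (hbL X τ) ^ (A + 1) := by rw [hL]
  · -- (iii) `(log X)^B ≤ exp(δ √(log L))`
    have hsq : 2 * B ^ 2 / δ ^ 2 * M ^ 2 ≤ τ * Lx := by
      have : τ * (2 * B ^ 2 / δ ^ 2 * M ^ (2 + ϖ)) ≤ τ * Lx :=
        mul_le_mul_of_nonneg_left h4 hτpos.le
      have h' : τ * (2 * B ^ 2 / δ ^ 2 * M ^ (2 + ϖ)) = 2 * B ^ 2 / δ ^ 2 * M ^ 2 := by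
        have := key 2
        calc τ * (2 * B ^ 2 / δ ^ 2 * M ^ (2 + ϖ))
            = 2 * B ^ 2 / δ ^ 2 * (τ * M ^ (2 + ϖ)) := by ring
          _ = 2 * B ^ 2 / δ ^ 2 * M ^ 2 := by
              rw [this, show ((2 : ℝ)) = ((2 : ℕ) : ℝ) by norm_num, Real.rpow_natCast]
      linarith
    have hBM : B * M ≤ δ * Real.sqrt (τ / 2 * Lx) := by
      rcases le_or_gt (B * M) 0 with hneg | hpos
      · exact hneg.trans (by positivity)
      · have hsq' : (B * M) ^ 2 ≤ (δ * Real.sqrt (τ / 2 * Lx)) ^ 2 := by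
          rw [mul_pow, mul_pow, Real.sq_sqrt (by positivity)]
          have : B ^ 2 * M ^ 2 = (2 * B ^ 2 / δ ^ 2 * M ^ 2) * (δ ^ 2 / 2) := by
            field_simp
          rw [this]
          calc 2 * B ^ 2 / δ ^ 2 * M ^ 2 * (δ ^ 2 / 2) ≤ τ * Lx * (δ ^ 2 / 2) :=
                mul_le_mul_of_nonneg_right hsq (by positivity)
            _ = δ ^ 2 * (τ / 2 * Lx) := by ring
        exact (pow_le_pow_iff_left₀ hpos.le (by positivity) two_ne_zero).mp hsq'
    calc Lx ^ B = Real.exp (Real.log Lx * B) := Real.rpow_def_of_pos hLx0 B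
      _ ≤ Real.exp (δ * Real.sqrt (Real.log (hbL X τ))) := by
          rw [hL, ← hM, mul_comm (M) B]; exact Real.exp_le_exp.mpr hBM

/-! ### Lemma 3.8 from Lemmas 8.1, 9.1 and 9.2 -/

set_option maxHeartbeats 400000 in
/-- **Heath-Brown's Lemma 3.8 from his Lemmas 8.1 and 9.2** ("A comparison of Lemmas 8.1, 9.1 and 9.2
immediately yields Lemma 3.8", p. 52; Harman: "Clearly Lemma 13.6 follows immediately from Lemmas
13.16–13.18"), with Lemma 9.1 proved above (`HeathBrown2001_lemma_9_1`). The hypotheses render the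
two printed lemmas in the standing set-up (`τ = (log log X)^{−ϖ}`, `0 < ϖ < 1/5`, `ξ = τ⁵`,
`L = X^{τ/2}`, `X ≥ X₀`, `𝐦` satisfying (3.5)–(3.7), the cube `𝒞` as in Lemma 3.8 with constants
`c₃, c₄`, `S₀ ≥ L²`):
* `h81` — **Lemma 8.1** (p. 47; Harman's Lemma 13.16): "Let `𝒞 ⊆ ℝ³` be as in Lemma 3.8. Define
  `N((x, y, z)) = x³ + 2y³ + 4z³ − 6xyz` and `𝓘 = ∫_𝒞 w'(N(𝐱)) dx dy dz`. Then for any positive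
  integer `q ≤ L^{1/6}` and any integer `α ∈ ℤ[2^{1/3}]` we have
  `∑_{β ≡ α (mod q), β̂ ∈ 𝒞} e_(β) = γ₀⁻¹M⁻¹(ξ log X)^{−n−1} 𝓘 ε(α, q)φ_K(q)⁻¹ + O(S₀³M⁻¹τ(q)^c exp{−c√(log L)})`,
  where `ε(α, q) = 1` if `α` and `q` are coprime, and `ε(α, q) = 0` otherwise", `M = ∏ m_i`, `φ_K`
  the Euler function of `K`, `τ(q)` the divisor function (constants `C, c, c'` depending on
  `ϖ, c₃, c₄`);
* `h92` — **Lemma 9.2** (p. 52; Harman's Lemma 13.18): "Let `𝒞 ⊆ ℝ³` be as in Lemma 3.8, and let a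
  positive integer `A` be given. Then for any natural number `q ≤ (log L)^A` and any integer
  `α ∈ ℤ[2^{1/3}]` coprime to `q` we have
  `∑_{β ≡ α (mod q), β̂ ∈ 𝒞} d_(β) = γ₀⁻¹M⁻¹φ_K(q)⁻¹(ξ log X)^{−n−1} 𝓘 + O_A(V exp{−c√(log L)})`,
  where `𝓘` is as in Lemma 8.1. We remark that the implied constant is ineffective, because of
  problems with Siegel zeros" (constants `C, c` depending on `ϖ, A, c₃, c₄`).
Proof (the printed sentence, with its bookkeeping): given `A > 0` apply `h92` with `⌈A⌉ + 1` and take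
`c₁ = min(c₈, c₉)/2`, `C₁ = max(C₉, 0) + 64c₃³ max(C₈, 0)` and `X₀` beyond the thresholds of `h81`,
`h92` and `eventually_lemma38_params`; for `q ≤ (log X)^A` one has `q ≤ L^{1/6}` and
`q ≤ (log L)^{⌈A⌉+1}`; if `(α, q) = (1)` then `∑ f = (∑ d − MT) − (∑ e − MT)` is bounded by the two
errors, otherwise `∑ d = 0` (Lemma 9.1), `ε = 0` and `∑ f = −∑ e` is bounded by the error of 8.1; finally
`S₀³ ≤ 64c₃³V`, `M⁻¹ ≤ 1`, `τ(q)^{c'} ≤ (log X)^{A max(c',0)} ≤ exp{(c₈/2)√(log L)}`.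
[cite: HeathBrownActa2001, Lemma 3.8 (via Lemmas 8.1, 9.1, 9.2, p. 52)] -/
theorem HeathBrown2001_lemma_3_8_of
    (h81 : ∀ ϖ : ℝ, 0 < ϖ → ϖ < 1 / 5 → ∀ c₃ c₄ : ℝ, 0 < c₃ → 0 < c₄ →
      ∃ C c c' X₀ : ℝ, 0 < c ∧ ∀ X : ℝ, X₀ ≤ X → ∀ (k : ℕ) (m : Fin k → ℕ),
        CoreAdmissible (hbTau ϖ X) m →
          ∀ q : ℕ, 1 ≤ q → (q : ℝ) ≤ hbL X (hbTau ϖ X) ^ (1 / 6 : ℝ) →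
            ∀ (α : 𝓞 K) (V : ℝ) (a : ℝ × ℝ × ℝ) (S₀ : ℝ), 0 < V →
              hbL X (hbTau ϖ X) ^ 2 ≤ S₀ → CubeCond c₃ c₄ V a S₀ →
                |cubeClassSum (eWeight X (hbTau ϖ X) m) q α a S₀ -
                    coprimeInd α q * swMainTerm X (hbTau ϖ X) m q a S₀| ≤
                  C * S₀ ^ 3 * (∏ i, (m i : ℝ))⁻¹ * ((Nat.divisors q).card : ℝ) ^ c' *
                    Real.exp (-(c * Real.sqrt (Real.log (hbL X (hbTau ϖ X))))))
    (h92 : ∀ ϖ : ℝ, 0 < ϖ → ϖ < 1 / 5 → ∀ A : ℕ, 0 < A → ∀ c₃ c₄ : ℝ, 0 < c₃ → 0 < c₄ →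
      ∃ C c X₀ : ℝ, 0 < c ∧ ∀ X : ℝ, X₀ ≤ X → ∀ (k : ℕ) (m : Fin k → ℕ),
        CoreAdmissible (hbTau ϖ X) m →
          ∀ q : ℕ, 1 ≤ q → (q : ℝ) ≤ Real.log (hbL X (hbTau ϖ X)) ^ A →
            ∀ α : 𝓞 K, IsCoprime α (q : 𝓞 K) →
              ∀ (V : ℝ) (a : ℝ × ℝ × ℝ) (S₀ : ℝ), 0 < V →
                hbL X (hbTau ϖ X) ^ 2 ≤ S₀ → CubeCond c₃ c₄ V a S₀ →
                  |cubeClassSum (dWeight X (hbTau ϖ X) m) q α a S₀ -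
                      swMainTerm X (hbTau ϖ X) m q a S₀| ≤
                    C * V * Real.exp (-(c * Real.sqrt (Real.log (hbL X (hbTau ϖ X)))))) :
    HeathBrown2001_lemma_3_8 := by
  intro ϖ hϖ0 hϖ5 A c₃ c₄ hA hc₃ hc₄
  obtain ⟨C₈, c₈, c₈', X₈, hc₈, H8⟩ := h81 ϖ hϖ0 hϖ5 c₃ c₄ hc₃ hc₄
  obtain ⟨C₉, c₉, X₉, hc₉, H9⟩ := h92 ϖ hϖ0 hϖ5 (⌈A⌉₊ + 1) (Nat.succ_pos _) c₃ c₄ hc₃ hc₄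
  clear h81 h92
  -- the thresholds
  obtain ⟨X₁, hX₁⟩ := Filter.eventually_atTop.mp
    (eventually_lemma38_params hϖ0 A (A * max c₈' 0) (half_pos hc₈))
  set c₁ : ℝ := min c₈ c₉ / 2 with hc₁def
  have hc₁pos : 0 < c₁ := by positivity
  have hc₁8 : c₁ ≤ c₈ / 2 := by
    rw [hc₁def]; linarith [min_le_left c₈ c₉]
  have hc₁9 : c₁ ≤ c₉ := by
    rw [hc₁def]; linarith [min_le_right c₈ c₉, hc₉]
  refine ⟨max C₉ 0 + 64 * c₃ ^ 3 * max C₈ 0, c₁, max X₁ (max X₈ X₉), hc₁pos, ?_⟩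
  intro X hX k m hm q hq1 hqA α V a S₀ hV hS₀ hcube
  have hXX₁ : X₁ ≤ X := le_trans (le_max_left _ _) hX
  have hXX₈ : X₈ ≤ X := le_trans ((le_max_left _ _).trans (le_max_right _ _)) hX
  have hXX₉ : X₉ ≤ X := le_trans ((le_max_right _ _).trans (le_max_right _ _)) hX
  obtain ⟨hX2, hτ0, hτ4, hlogL1, hi, hii, hiii⟩ := hX₁ X hXX₁
  set τ := hbTau ϖ X with hτdef
  set L := hbL X τ with hLdef
  set ℓ := Real.log L with hℓdef
  have hX1 : 1 < X := by linarith
  have hX0 : 0 < X := by linarith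
  have hτ1 : τ ≤ 1 := by linarith
  have hLx0 : 0 < Real.log X := Real.log_pos hX1
  have hLpos : 0 < L := hbL_pos hX0 τ
  have hS₀pos : 0 < S₀ := lt_of_lt_of_le (pow_pos hLpos 2) hS₀
  -- the `q`-ranges
  have hq6 : (q : ℝ) ≤ L ^ (1 / 6 : ℝ) := hqA.trans hi
  have hqlog : (q : ℝ) ≤ ℓ ^ (⌈A⌉₊ + 1) := by
    refine hqA.trans (hii.trans ?_)
    rw [← Real.rpow_natCast]
    refine Real.rpow_le_rpow_of_exponent_le hlogL1 ?_
    push_cast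
    linarith [Nat.le_ceil A]
  -- the two error terms
  set E₈ : ℝ := C₈ * S₀ ^ 3 * (∏ i, (m i : ℝ))⁻¹ * ((Nat.divisors q).card : ℝ) ^ c₈' *
    Real.exp (-(c₈ * Real.sqrt ℓ)) with hE₈
  set E₉ : ℝ := C₉ * V * Real.exp (-(c₉ * Real.sqrt ℓ)) with hE₉
  have h8 := H8 X hXX₈ k m hm q hq1 hq6 α V a S₀ hV hS₀ hcube
  -- bound for `E₉`
  have hsqrt : 0 ≤ Real.sqrt ℓ := Real.sqrt_nonneg ℓ
  have hexp9 : Real.exp (-(c₉ * Real.sqrt ℓ)) ≤ Real.exp (-(c₁ * Real.sqrt ℓ)) := by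
    apply Real.exp_le_exp.mpr; nlinarith
  have hE₉le : E₉ ≤ max C₉ 0 * V * Real.exp (-(c₁ * Real.sqrt ℓ)) := by
    calc E₉ ≤ max C₉ 0 * V * Real.exp (-(c₉ * Real.sqrt ℓ)) := by
          rw [hE₉]; gcongr; exact le_max_left _ _
      _ ≤ max C₉ 0 * V * Real.exp (-(c₁ * Real.sqrt ℓ)) := by gcongr
  -- bound for `E₈`
  have hM1 : (1 : ℝ) ≤ ∏ i, (m i : ℝ) := one_le_prod_of_coreAdmissible hτ0 hτ1 hm
  have hMinv : (∏ i, (m i : ℝ))⁻¹ ≤ 1 := inv_le_one_of_one_le₀ hM1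
  have hMinv0 : 0 ≤ (∏ i, (m i : ℝ))⁻¹ := inv_nonneg.mpr (by linarith)
  have hS₀3 : S₀ ^ 3 ≤ 64 * c₃ ^ 3 * V := side_pow_three_le_of_cubeCond hS₀pos hV.le hcube
  have hdiv : ((Nat.divisors q).card : ℝ) ^ c₈' ≤ Real.log X ^ (A * max c₈' 0) := by
    refine (card_divisors_rpow_le hq1 hqA c₈').trans_eq ?_
    rw [← Real.rpow_mul hLx0.le]
  have hdiv0 : 0 ≤ ((Nat.divisors q).card : ℝ) ^ c₈' := Real.rpow_nonneg (Nat.cast_nonneg _) _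
  have hexp8 : Real.log X ^ (A * max c₈' 0) * Real.exp (-(c₈ * Real.sqrt ℓ)) ≤
      Real.exp (-(c₁ * Real.sqrt ℓ)) := by
    calc Real.log X ^ (A * max c₈' 0) * Real.exp (-(c₈ * Real.sqrt ℓ))
        ≤ Real.exp (c₈ / 2 * Real.sqrt ℓ) * Real.exp (-(c₈ * Real.sqrt ℓ)) :=
          mul_le_mul_of_nonneg_right hiii (Real.exp_pos _).le
      _ = Real.exp (-(c₈ / 2 * Real.sqrt ℓ)) := by rw [← Real.exp_add]; ring_nf
      _ ≤ Real.exp (-(c₁ * Real.sqrt ℓ)) := by apply Real.exp_le_exp.mpr; nlinarith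
  have hE₈le : E₈ ≤ max C₈ 0 * (64 * c₃ ^ 3 * V) * Real.exp (-(c₁ * Real.sqrt ℓ)) := by
    calc E₈ ≤ max C₈ 0 * S₀ ^ 3 * (∏ i, (m i : ℝ))⁻¹ * ((Nat.divisors q).card : ℝ) ^ c₈' *
          Real.exp (-(c₈ * Real.sqrt ℓ)) := by
          rw [hE₈]; gcongr; exact le_max_left _ _
      _ ≤ max C₈ 0 * (64 * c₃ ^ 3 * V) * 1 * (Real.log X ^ (A * max c₈' 0)) *
          Real.exp (-(c₈ * Real.sqrt ℓ)) := by gcongr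
      _ = max C₈ 0 * (64 * c₃ ^ 3 * V) *
          (Real.log X ^ (A * max c₈' 0) * Real.exp (-(c₈ * Real.sqrt ℓ))) := by ring
      _ ≤ max C₈ 0 * (64 * c₃ ^ 3 * V) * Real.exp (-(c₁ * Real.sqrt ℓ)) := by gcongr
  -- the comparison of Lemmas 8.1, 9.1, 9.2
  have hmain : |swSum X τ m q α a S₀| ≤ E₉ ⊔ 0 + E₈ := by
    rw [swSum_eq_sub]
    by_cases hcop : IsCoprime α (q : 𝓞 K)
    · have h9 := H9 X hXX₉ k m hm q hq1 hqlog α hcop V a S₀ hV hS₀ hcube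
      rw [coprimeInd_of_isCoprime hcop, one_mul] at h8
      calc |cubeClassSum (dWeight X τ m) q α a S₀ - cubeClassSum (eWeight X τ m) q α a S₀|
          = |(cubeClassSum (dWeight X τ m) q α a S₀ - swMainTerm X τ m q a S₀) -
              (cubeClassSum (eWeight X τ m) q α a S₀ - swMainTerm X τ m q a S₀)| := by ring_nf
        _ ≤ |cubeClassSum (dWeight X τ m) q α a S₀ - swMainTerm X τ m q a S₀| +
              |cubeClassSum (eWeight X τ m) q α a S₀ - swMainTerm X τ m q a S₀| := abs_sub _ _
        _ ≤ E₉ + E₈ := add_le_add h9 h8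
        _ ≤ E₉ ⊔ 0 + E₈ := by gcongr; exact le_max_left _ _
    · have h91 := HeathBrown2001_lemma_9_1 hX1 hτ0 hm hq1 hq6 hcop a S₀
      rw [coprimeInd_of_not_isCoprime hcop, zero_mul, sub_zero] at h8
      rw [h91, zero_sub, abs_neg]
      calc |cubeClassSum (eWeight X τ m) q α a S₀| ≤ E₈ := h8
        _ ≤ E₉ ⊔ 0 + E₈ := le_add_of_nonneg_left (le_max_right _ _)
  have hE₉' : E₉ ⊔ 0 ≤ max C₉ 0 * V * Real.exp (-(c₁ * Real.sqrt ℓ)) :=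
    max_le hE₉le (by positivity)
  calc |swSum X τ m q α a S₀| ≤ E₉ ⊔ 0 + E₈ := hmain
    _ ≤ max C₉ 0 * V * Real.exp (-(c₁ * Real.sqrt ℓ)) +
          max C₈ 0 * (64 * c₃ ^ 3 * V) * Real.exp (-(c₁ * Real.sqrt ℓ)) := add_le_add hE₉' hE₈le
    _ = (max C₉ 0 + 64 * c₃ ^ 3 * max C₈ 0) * V * Real.exp (-(c₁ * Real.sqrt ℓ)) := by ring

end Literature.NumberTheory.Sieve.CubicSieve

end
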